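/-
Solo-blind programme (Kontsevich–Zagier periods), session s19.
-/
import Summits.KontsevichZagierPeriods.KontsevichZagierPeriods.Theorems.SoloBlindDepthTwo

/-!
# Depth three and the chain rule at the base point `−1`

Pure matrix algebra over a commutative ring: the kernel of the paper-level THEOREM D.23 (depth three)
and of the chain-product lemma behind THEOREM D.25 (all depths) of the solo-blind notes
(`hodge.md` §8.12), which are NOT formalised here and are only context.

Context (paper level).  For a word of odd block lengths `(a, b, c)` (`w = a + b + c`) the iterated-integral
Hodge–Tate structure `M_{(a,b,c)}(−1)` has rank `w + 1`, three polylogarithm blocks on `[0,a]`, `[a,a+b]`,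
`[a+b,w]` and top period `± Li_{a,b,c}(−1) = ± Σ_{0<l<m<n} (−1)ⁿ/(lᵃ mᵇ nᶜ)`.  Elements of the graded Lie
algebra `𝔲⁰` are sums of HOMOGENEOUS matrices (supported on one superdiagonal); the lifted block corners
`A`, `B`, `C` are homogeneous of degrees `a`, `b`, `c` with `A 0 a = B a (a+b) = C (a+b) w = 1`, and an
entry `(i, i+d)` of an element of `𝔲⁰` vanishes unless the half-open interval `[i, i+d)` contains one of
the block boundaries `0, a, a+b`.  The identities below compute the corner `(0, w)` of the two triple
brackets and of an arbitrary product of homogeneous matrices; fed with the vanishing rule they give the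
new corner direction `E 0 w` exactly for the right-nested bracket when `c > max(a,b)` and for the
left-nested bracket when `a < min(b,c)` (paper level), i.e. for the Lyndon bracketings.  Nothing about
periods, Hodge theory or the Kontsevich–Zagier statement is claimed in this file.

Main statements (ambient size `n + 2`, last index `w` with `(w : ℕ) = n + 1`):
* `Homog d A`            : `A` is supported on the `d`-th superdiagonal; closed under `*` and `⁅,⁆`
                           with degrees adding (`Homog.mul`, `Homog.lie`);
* `homog_mul_apply`, `lie_homog_apply` : general-position entries of `A * B` and `⁅A, B⁆`;
* `lie3_right`, `lie3_left` : for `A, B, C` homogeneous of degrees `a, b, c`, `a + b + c = n + 1`,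
    `⁅A, ⁅B, C⁆⁆ = (A 0 a * (B a (a+b) * C (a+b) w − C a (a+c) * B (a+c) w)
                     − (B 0 b * C b (b+c) − C 0 c * B c (b+c)) * A (b+c) w) • E 0 w`,
    `⁅⁅A, B⁆, C⁆ = ((A 0 a * B a (a+b) − B 0 b * A b (a+b)) * C (a+b) w
                     − C 0 c * (A c (a+c) * B (a+c) w − B c (b+c) * A (b+c) w)) • E 0 w`;
* `right_corner_of_block_lifts`, `left_corner_of_block_lifts`, `left_corner_of_block_lifts'` :
    the corollaries `= E 0 w` under the zero-entry hypotheses, and `lie3_right_eq_zero`,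
    `lie3_left_eq_zero` (off-diagonal vanishing for the triangular Jacobian);
* `chain`, `homog_listProd`, `listProd_apply`, `listProd_eq_smul_E` : a product of homogeneous
    matrices of degrees `d₁, …, d_m` is homogeneous of degree `Σ dᵢ`, its on-degree entries are the
    chain products `A₁ i (i+d₁) * A₂ (i+d₁) (i+d₁+d₂) * ⋯`, and when `Σ dᵢ = n + 1` the product is
    `(chain at row 0) • E 0 w` (all depths).
-/

namespace Summit.KontsevichZagierPeriods.KontsevichZagierPeriods.Theorems

namespace SoloBlind

namespace DepthThree

open Matrix PolylogLadder DepthTwo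

variable {K : Type*} [CommRing K] {n : ℕ}

local notation "𝕄" => Matrix (Fin (n + 2)) (Fin (n + 2)) K

/-! ## Homogeneous matrices -/

/-- `A` is homogeneous of degree `d`: it is supported on the `d`-th superdiagonal. -/
def Homog (d : ℕ) (A : 𝕄) : Prop := ∀ i j : Fin (n + 2), (j : ℕ) ≠ i + d → A i j = 0

/-- Off-degree entries of a homogeneous matrix vanish. -/
theorem Homog.apply_eq_zero {d : ℕ} {A : 𝕄} (hA : Homog d A) {i j : Fin (n + 2)}
    (h : (j : ℕ) ≠ i + d) : A i j = 0 := hA i j h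

/-- Homogeneous matrices of the same degree are closed under addition. -/
theorem Homog.add {d : ℕ} {A B : 𝕄} (hA : Homog d A) (hB : Homog d B) : Homog d (A + B) := by
  intro i j h
  rw [Matrix.add_apply, hA i j h, hB i j h, add_zero]

/-- Homogeneous matrices of the same degree are closed under subtraction. -/
theorem Homog.sub {d : ℕ} {A B : 𝕄} (hA : Homog d A) (hB : Homog d B) : Homog d (A - B) := by
  intro i j h
  rw [Matrix.sub_apply, hA i j h, hB i j h, sub_zero]

/-- Homogeneous matrices of a given degree are closed under scalars. -/
theorem Homog.smul {d : ℕ} {A : 𝕄} (c : K) (hA : Homog d A) : Homog d (c • A) := by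
  intro i j h
  rw [Matrix.smul_apply, hA i j h, smul_zero]

/-- The zero matrix is homogeneous of every degree. -/
theorem Homog.zero (d : ℕ) : Homog d (0 : 𝕄) := fun _ _ _ => rfl

/-- The identity is homogeneous of degree `0`. -/
theorem Homog.one : Homog 0 (1 : 𝕄) := by
  intro i j h
  apply Matrix.one_apply_ne
  intro hij
  apply h
  rw [hij, add_zero]

/-- A matrix unit `E p q` is homogeneous of degree `q − p`. -/
theorem Homog_E (p q : Fin (n + 2)) (d : ℕ) (hq : (q : ℕ) = p + d) : Homog d (E K p q : 𝕄) := by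
  intro i j h
  rw [E_apply, if_neg]
  rintro ⟨hi, hj⟩
  apply h
  rw [hi, hj, hq]

/-- General-position entry of `A * B` for `A` homogeneous of degree `a`: the sum collapses to the
single index `l = i + a`. -/
theorem homog_mul_apply {a : ℕ} {A : 𝕄} (hA : Homog a A) (B : 𝕄) (i l k : Fin (n + 2))
    (hl : (l : ℕ) = i + a) : (A * B) i k = A i l * B l k := by
  rw [Matrix.mul_apply, Finset.sum_eq_single l]
  · intro m _ hm
    rw [hA i m ?_, zero_mul]
    intro h
    apply hm
    exact Fin.ext (by omega)
  · intro h
    exact absurd (Finset.mem_univ l) h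

/-- If the row index is too large for degree `a`, the whole row of `A * B` vanishes. -/
theorem homog_mul_apply_of_le {a : ℕ} {A : 𝕄} (hA : Homog a A) (B : 𝕄) (i k : Fin (n + 2))
    (hi : n + 2 ≤ (i : ℕ) + a) : (A * B) i k = 0 := by
  rw [Matrix.mul_apply]
  apply Finset.sum_eq_zero
  intro m _
  rw [hA i m ?_, zero_mul]
  have hm := m.isLt
  omega

/-- Degrees add under multiplication. -/
theorem Homog.mul {a b : ℕ} {A B : 𝕄} (hA : Homog a A) (hB : Homog b B) :
    Homog (a + b) (A * B) := by
  intro i k hk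
  rw [Matrix.mul_apply]
  apply Finset.sum_eq_zero
  intro m _
  by_cases h1 : (m : ℕ) = i + a
  · rw [hB m k (by omega), mul_zero]
  · rw [hA i m h1, zero_mul]

/-- Degrees add under the commutator. -/
theorem Homog.lie {a b : ℕ} {A B : 𝕄} (hA : Homog a A) (hB : Homog b B) :
    Homog (a + b) ⁅A, B⁆ := by
  intro i k hk
  rw [Ring.lie_def, Matrix.sub_apply, (hA.mul hB) i k hk, (hB.mul hA) i k (by omega), sub_zero]

/-- General-position entry of the commutator of two homogeneous matrices. -/
theorem lie_homog_apply {a b : ℕ} {A B : 𝕄} (hA : Homog a A) (hB : Homog b B)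
    (i l l' k : Fin (n + 2)) (hl : (l : ℕ) = i + a) (hl' : (l' : ℕ) = i + b) :
    ⁅A, B⁆ i k = A i l * B l k - B i l' * A l' k := by
  rw [Ring.lie_def, Matrix.sub_apply, homog_mul_apply hA B i l k hl, homog_mul_apply hB A i l' k hl']

/-! ## The two triple brackets -/

/-- Right-nested triple bracket of homogeneous matrices of degrees `a + b + c = n + 1`. -/
theorem lie3_right (a b c ab ac bc w : Fin (n + 2)) (hw : (w : ℕ) = n + 1)
    (habc : (a : ℕ) + b + c = n + 1) (hab : (ab : ℕ) = a + b) (hac : (ac : ℕ) = a + c)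
    (hbc : (bc : ℕ) = b + c) (A B C : 𝕄) (hA : Homog a A) (hB : Homog b B) (hC : Homog c C) :
    ⁅A, ⁅B, C⁆⁆ = (A 0 a * (B a ab * C ab w - C a ac * B ac w)
        - (B 0 b * C b bc - C 0 c * B c bc) * A bc w) • (E K 0 w : 𝕄) := by
  have hD : Homog ((b : ℕ) + c) ⁅B, C⁆ := hB.lie hC
  rw [lie_homog_corner a bc w hw (by omega) A ⁅B, C⁆ hA (fun i j h => hD i j (by omega)),
    lie_homog_apply hB hC a ab ac w hab hac,
    lie_homog_apply hB hC 0 b c bc (by simp) (by simp)]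

/-- Left-nested triple bracket of homogeneous matrices of degrees `a + b + c = n + 1`. -/
theorem lie3_left (a b c ab ac bc w : Fin (n + 2)) (hw : (w : ℕ) = n + 1)
    (habc : (a : ℕ) + b + c = n + 1) (hab : (ab : ℕ) = a + b) (hac : (ac : ℕ) = a + c)
    (hbc : (bc : ℕ) = b + c) (A B C : 𝕄) (hA : Homog a A) (hB : Homog b B) (hC : Homog c C) :
    ⁅⁅A, B⁆, C⁆ = ((A 0 a * B a ab - B 0 b * A b ab) * C ab w
        - C 0 c * (A c ac * B ac w - B c bc * A bc w)) • (E K 0 w : 𝕄) := by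
  have hD : Homog ((a : ℕ) + b) ⁅A, B⁆ := hA.lie hB
  rw [lie_homog_corner ab c w hw (by omega) ⁅A, B⁆ C (fun i j h => hD i j (by omega)) hC,
    lie_homog_apply hA hB 0 a b ab (by simp) (by simp),
    lie_homog_apply hA hB c ac bc w (by omega) (by omega)]

/-- THEOREM D.23 (R), matrix part: three lifted block corners (`A 0 a = 1`, `B a (a+b) = 1`,
`C (a+b) w = 1`) whose entries `B (a+c) w` and `A (b+c) w` vanish (paper level: they do when
`c > max (a, b)`, both intervals `[a+c, w)` and `[b+c, w)` then containing no block boundary)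
bracket to the new corner: `⁅A, ⁅B, C⁆⁆ = E 0 w`. -/
theorem right_corner_of_block_lifts (a b c ab ac bc w : Fin (n + 2)) (hw : (w : ℕ) = n + 1)
    (habc : (a : ℕ) + b + c = n + 1) (hab : (ab : ℕ) = a + b) (hac : (ac : ℕ) = a + c)
    (hbc : (bc : ℕ) = b + c) (A B C : 𝕄) (hA : Homog a A) (hB : Homog b B) (hC : Homog c C)
    (hA0 : A 0 a = 1) (hB1 : B a ab = 1) (hC1 : C ab w = 1) (hB0 : B ac w = 0)
    (hA1 : A bc w = 0) : ⁅A, ⁅B, C⁆⁆ = (E K 0 w : 𝕄) := by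
  rw [lie3_right a b c ab ac bc w hw habc hab hac hbc A B C hA hB hC, hA0, hB1, hC1, hB0, hA1]
  simp

/-- THEOREM D.23 (L), matrix part, case `b < c`: `A b (a+b) = 0`, `B (a+c) w = 0`, `A (b+c) w = 0`
give `⁅⁅A, B⁆, C⁆ = E 0 w`. -/
theorem left_corner_of_block_lifts (a b c ab ac bc w : Fin (n + 2)) (hw : (w : ℕ) = n + 1)
    (habc : (a : ℕ) + b + c = n + 1) (hab : (ab : ℕ) = a + b) (hac : (ac : ℕ) = a + c)
    (hbc : (bc : ℕ) = b + c) (A B C : 𝕄) (hA : Homog a A) (hB : Homog b B) (hC : Homog c C)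
    (hA0 : A 0 a = 1) (hB1 : B a ab = 1) (hC1 : C ab w = 1) (hAb : A b ab = 0)
    (hB0 : B ac w = 0) (hA1 : A bc w = 0) : ⁅⁅A, B⁆, C⁆ = (E K 0 w : 𝕄) := by
  rw [lie3_left a b c ab ac bc w hw habc hab hac hbc A B C hA hB hC, hA0, hB1, hC1, hAb, hB0, hA1]
  simp

/-- THEOREM D.23 (L), matrix part, case `c ≤ b` (in particular the Lyndon words `(p, q, q)`, `p < q`):
`A b (a+b) = 0`, `A c (a+c) = 0`, `A (b+c) w = 0` give `⁅⁅A, B⁆, C⁆ = E 0 w`. -/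
theorem left_corner_of_block_lifts' (a b c ab ac bc w : Fin (n + 2)) (hw : (w : ℕ) = n + 1)
    (habc : (a : ℕ) + b + c = n + 1) (hab : (ab : ℕ) = a + b) (hac : (ac : ℕ) = a + c)
    (hbc : (bc : ℕ) = b + c) (A B C : 𝕄) (hA : Homog a A) (hB : Homog b B) (hC : Homog c C)
    (hA0 : A 0 a = 1) (hB1 : B a ab = 1) (hC1 : C ab w = 1) (hAb : A b ab = 0)
    (hAc : A c ac = 0) (hA1 : A bc w = 0) : ⁅⁅A, B⁆, C⁆ = (E K 0 w : 𝕄) := by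
  rw [lie3_left a b c ab ac bc w hw habc hab hac hbc A B C hA hB hC, hA0, hB1, hC1, hAb, hAc, hA1]
  simp

/-- Off-diagonal vanishing, right-nested: if both summands of the corner vanish then
`⁅A, ⁅B, C⁆⁆ = 0`. -/
theorem lie3_right_eq_zero (a b c ab ac bc w : Fin (n + 2)) (hw : (w : ℕ) = n + 1)
    (habc : (a : ℕ) + b + c = n + 1) (hab : (ab : ℕ) = a + b) (hac : (ac : ℕ) = a + c)
    (hbc : (bc : ℕ) = b + c) (A B C : 𝕄) (hA : Homog a A) (hB : Homog b B) (hC : Homog c C)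
    (h1 : A 0 a * (B a ab * C ab w - C a ac * B ac w) = 0)
    (h2 : (B 0 b * C b bc - C 0 c * B c bc) * A bc w = 0) : ⁅A, ⁅B, C⁆⁆ = 0 := by
  rw [lie3_right a b c ab ac bc w hw habc hab hac hbc A B C hA hB hC, h1, h2]
  simp

/-- Off-diagonal vanishing, left-nested. -/
theorem lie3_left_eq_zero (a b c ab ac bc w : Fin (n + 2)) (hw : (w : ℕ) = n + 1)
    (habc : (a : ℕ) + b + c = n + 1) (hab : (ab : ℕ) = a + b) (hac : (ac : ℕ) = a + c)
    (hbc : (bc : ℕ) = b + c) (A B C : 𝕄) (hA : Homog a A) (hB : Homog b B) (hC : Homog c C)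
    (h1 : (A 0 a * B a ab - B 0 b * A b ab) * C ab w = 0)
    (h2 : C 0 c * (A c ac * B ac w - B c bc * A bc w) = 0) : ⁅⁅A, B⁆, C⁆ = 0 := by
  rw [lie3_left a b c ab ac bc w hw habc hab hac hbc A B C hA hB hC, h1, h2]
  simp

/-! ## The chain rule for products of homogeneous matrices (all depths) -/

/-- The chain product of on-degree entries of a list of (degree, matrix) pairs, starting at row `i`:
`chain [(d₁,A₁), (d₂,A₂), …] i = A₁ i (i+d₁) * A₂ (i+d₁) (i+d₁+d₂) * ⋯` (and `0` as soon as an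
index leaves the range). -/
def chain : List (ℕ × 𝕄) → Fin (n + 2) → K
  | [], _ => 1
  | (d, A) :: t, i => if h : (i : ℕ) + d < n + 2 then A i ⟨i + d, h⟩ * chain t ⟨i + d, h⟩ else 0

/-- The empty chain product is `1`. -/
@[simp] theorem chain_nil (i : Fin (n + 2)) : chain ([] : List (ℕ × 𝕄)) i = 1 := rfl

/-- Unfolding the chain product at its head. -/
theorem chain_cons (d : ℕ) (A : 𝕄) (t : List (ℕ × 𝕄)) (i : Fin (n + 2)) :
    chain ((d, A) :: t) i =
      if h : (i : ℕ) + d < n + 2 then A i ⟨i + d, h⟩ * chain t ⟨i + d, h⟩ else 0 := rfl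

/-- A product of homogeneous matrices is homogeneous of the total degree. -/
theorem homog_listProd (L : List (ℕ × 𝕄)) (hL : ∀ p ∈ L, Homog p.1 p.2) :
    Homog (L.map Prod.fst).sum (L.map Prod.snd).prod := by
  induction L with
  | nil => simpa using (Homog.one : Homog 0 (1 : 𝕄))
  | cons p t ih =>
    obtain ⟨d, A⟩ := p
    simp only [List.map_cons, List.sum_cons, List.prod_cons]
    exact (hL (d, A) (by simp)).mul (ih (fun q hq => hL q (by simp [hq])))

/-- The on-degree entries of a product of homogeneous matrices are the chain products. -/
theorem listProd_apply (L : List (ℕ × 𝕄)) (hL : ∀ p ∈ L, Homog p.1 p.2) (i k : Fin (n + 2))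
    (hk : (k : ℕ) = i + (L.map Prod.fst).sum) : (L.map Prod.snd).prod i k = chain L i := by
  induction L generalizing i with
  | nil =>
    simp only [List.map_nil, List.sum_nil, add_zero] at hk
    have hki : k = i := Fin.ext hk
    simp [hki]
  | cons p t ih =>
    obtain ⟨d, A⟩ := p
    simp only [List.map_cons, List.sum_cons, List.prod_cons] at hk ⊢
    have hA : Homog d A := hL (d, A) (by simp)
    have ht : ∀ q ∈ t, Homog q.1 q.2 := fun q hq => hL q (by simp [hq])
    rw [chain_cons]
    by_cases h : (i : ℕ) + d < n + 2
    · rw [dif_pos h, homog_mul_apply hA _ i ⟨i + d, h⟩ k rfl, ih ht ⟨i + d, h⟩ (by simpa [add_assoc] using hk)]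
    · exfalso
      have := k.isLt
      omega

/-- All depths, corner form: if the degrees add up to `n + 1` (the last index `w`), the product of the
homogeneous matrices IS `(chain at row 0) • E 0 w`. -/
theorem listProd_eq_smul_E (L : List (ℕ × 𝕄)) (hL : ∀ p ∈ L, Homog p.1 p.2) (w : Fin (n + 2))
    (hw : (w : ℕ) = n + 1) (hsum : (L.map Prod.fst).sum = n + 1) :
    (L.map Prod.snd).prod = chain L 0 • (E K 0 w : 𝕄) := by
  have hH := homog_listProd L hL
  ext i k
  rw [Matrix.smul_apply, E_apply, smul_eq_mul]
  by_cases hik : i = 0 ∧ k = w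
  · obtain ⟨hi, hk⟩ := hik
    subst hi
    rw [hk, if_pos ⟨rfl, rfl⟩, mul_one]
    exact listProd_apply L hL 0 w (by simp [hw, hsum])
  · rw [if_neg hik, mul_zero]
    apply hH i k
    intro h
    apply hik
    have hi := i.isLt
    have hk := k.isLt
    refine ⟨Fin.ext ?_, Fin.ext ?_⟩
    · simp only [Fin.val_zero]; omega
    · rw [hw]; omega

end DepthThree

end SoloBlind

end Summit.KontsevichZagierPeriods.KontsevichZagierPeriods.Theorems
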